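import Summits.KontsevichZagierPeriods.KontsevichZagierPeriods.Theorems.SoloBlindFenceMove
import HarnessLib

/-!
# The fence dissection (`T2`, file D1)

The fence cell `F_n` of `SoloBlindFenceChart` (`s₁ < s₂ > s₃ < ⋯` plus the two angle bounds) is
dissected — rule (1), ties being null — by the ORDER TYPE `ρ` of `u = (s₁, …, s_{n+1})` into the
pieces `F_ρ = F_n ∩ {u ∈ C_ρ}`, `ρ` ranging over the permutations compatible with the fence:
`fenceSet n`, of cardinality `fenceCount n` (`fenceCount 1 = 1`, `fenceCount 3 = 5`,
`fenceCount 5 = 61`: the Euler–André numbers `E_{n+1}`).  In `Q`: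

  `[F_n, w] = Σ_{ρ ∈ fenceSet n} [F_ρ, w]`   (`mkQ_fencePiece_eq_sum`).

Also recorded: the lift `liftPerm ρ = (0, ρ+1)` of `ρ` to `Fin (n+2)` and the description of its
order cell (`mem_orderCellK_liftPerm`), the target of the doubling chart of file D2.
-/

noncomputable section

open Literature.NumberTheory.Transcendental Literature.NumberTheory.Transcendental.KZ
open Literature.ModelTheory.ExponentialFields
open MeasureTheory Set Real

namespace Summit.KontsevichZagierPeriods.KontsevichZagierPeriods.Theorems

namespace SoloBlind

variable {n : ℕ}

/-! ## Fence permutations -/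

/-- `ρ` (the order type of `u`, `u ∘ ρ` decreasing) is compatible with `u₀ < u₁ > u₂ < ⋯`. -/
def IsFencePerm (ρ : Equiv.Perm (Fin (n + 1))) : Prop :=
  ∀ j : Fin n, (Even j.val → ρ.symm j.succ < ρ.symm j.castSucc) ∧
    (¬ Even j.val → ρ.symm j.castSucc < ρ.symm j.succ)

/-- Decidability of `IsFencePerm`. -/
instance (ρ : Equiv.Perm (Fin (n + 1))) : Decidable (IsFencePerm ρ) := by
  unfold IsFencePerm; infer_instance

/-- The fence-compatible permutations. -/
def fenceSet (n : ℕ) : Finset (Equiv.Perm (Fin (n + 1))) :=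
  Finset.univ.filter fun ρ => IsFencePerm ρ

/-- Their number (`E_{n+1}`, Euler–André). -/
def fenceCount (n : ℕ) : ℕ := (fenceSet n).card

/-- Membership in `fenceSet`. -/
theorem mem_fenceSet {ρ : Equiv.Perm (Fin (n + 1))} : ρ ∈ fenceSet n ↔ IsFencePerm ρ := by
  simp [fenceSet]

/-- `fenceCount 1 = 1` (`k = 3`). -/
theorem fenceCount_one : fenceCount 1 = 1 := by decide

/-- `fenceCount 3 = 5` (`k = 5`). -/
theorem fenceCount_three : fenceCount 3 = 5 := by decide

/-- `fenceCount 5 = 61` (`k = 7`). -/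
theorem fenceCount_five : fenceCount 5 = 61 := by decide

/-! ## The fence read on `u = (s₁, …, s_{n+1})` -/

/-- The fence conditions on `u`: `u₀ < u₁ > u₂ < ⋯`. -/
def IsFenceTail (u : Fin (n + 1) → ℝ) : Prop :=
  ∀ j : Fin n, (Even j.val → u j.castSucc < u j.succ) ∧ (¬ Even j.val → u j.succ < u j.castSucc)

/-- `(castSucc j).succ + 1 = j.succ.succ` in `Fin (n+2)`. -/
theorem succ_castSucc_add_one (j : Fin n) :
    ((Fin.castSucc j).succ : Fin (n + 2)) + 1 = j.succ.succ := by
  rw [Fin.succ_castSucc, Fin.coeSucc_eq_succ]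

/-- `IsFence s ↔ IsFenceTail (s ∘ succ)`. -/
theorem isFence_iff_tail {s : Fin (n + 2) → ℝ} :
    IsFence s ↔ IsFenceTail fun j => s j.succ := by
  constructor
  · intro h j
    have h0 : ((Fin.castSucc j).succ : Fin (n + 2)) ≠ 0 := Fin.succ_ne_zero _
    have h1 : ((Fin.castSucc j).succ : Fin (n + 2)) + 1 ≠ 0 := by
      rw [succ_castSucc_add_one]; exact Fin.succ_ne_zero _
    have hj := h _ h0 h1
    have hv : ((Fin.castSucc j).succ : Fin (n + 2)).val = j.val + 1 := by simp
    rw [succ_castSucc_add_one, hv, Nat.even_add_one, not_not] at hj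
    exact ⟨fun he => hj.2 he, fun ho => hj.1 ho⟩
  · intro h i hi0 hi1
    obtain ⟨i', rfl⟩ := Fin.exists_succ_eq.mpr hi0
    have hne : i' ≠ Fin.last n := by
      rintro rfl
      exact hi1 (by rw [Fin.succ_last, Fin.last_add_one])
    obtain ⟨j, rfl⟩ := Fin.exists_castSucc_eq.mpr hne
    have hv : ((Fin.castSucc j).succ : Fin (n + 2)).val = j.val + 1 := by simp
    rw [succ_castSucc_add_one, hv, Nat.even_add_one, not_not]
    exact ⟨fun ho => (h j).2 ho, fun he => (h j).1 he⟩

/-- With `u ∘ ρ` decreasing, the fence conditions on `u` are conditions on `ρ`. -/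
theorem isFenceTail_iff_perm {u : Fin (n + 1) → ℝ} {ρ : Equiv.Perm (Fin (n + 1))}
    (hu : StrictAnti fun i => u (ρ i)) : IsFenceTail u ↔ IsFencePerm ρ := by
  have key : ∀ a b, u a < u b ↔ ρ.symm b < ρ.symm a := fun a b => by
    simpa using StrictAnti.lt_iff_gt hu (a := ρ.symm a) (b := ρ.symm b)
  simp only [IsFenceTail, IsFencePerm, key]

/-! ## The pieces `F_ρ` -/

/-- `F_ρ = F_n ∩ {(s₁,…,s_{n+1}) ∈ C_ρ}`. -/
def fenceOrd (ρ : Equiv.Perm (Fin (n + 1))) : Set (Fin (n + 2) → ℝ) :=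
  fenceCell n ∩ (fun s : Fin (n + 2) → ℝ => s ∘ Fin.succ) ⁻¹' (orderCellK ρ).domain

/-- Membership in `F_ρ`. -/
theorem mem_fenceOrd {ρ : Equiv.Perm (Fin (n + 1))} {s : Fin (n + 2) → ℝ} :
    s ∈ fenceOrd ρ ↔ s ∈ fenceCell n ∧ (fun j => s j.succ) ∈ (orderCellK ρ).domain := Iff.rfl

/-- `F_ρ` is `ℚ`-semialgebraic. -/
theorem isSemialgebraic_fenceOrd (ρ : Equiv.Perm (Fin (n + 1))) :
    IsSemialgebraic ℚ (fenceOrd ρ) :=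
  (isSemialgebraic_fenceCell n).inter ((orderCellK ρ).isSemialgebraic_domain.preimage_comp _)

/-- `F_ρ ⊆ (0,1)^{n+2}`. -/
theorem fenceOrd_subset (ρ : Equiv.Perm (Fin (n + 1))) : fenceOrd ρ ⊆ kzOpenBox (n + 2) :=
  fun _ hs => fenceCell_subset_kzOpenBox hs.1

/-- `[F_ρ, w]`. -/
def fenceOrdPiece (ρ : Equiv.Perm (Fin (n + 1))) : IntegralRep (n + 2) :=
  angPiece (fenceOrd ρ) (isSemialgebraic_fenceOrd ρ) (fenceOrd_subset ρ)

/-- On `F_n`, off the ties, some `F_ρ` with `ρ ∈ fenceSet n` contains `s`. -/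
theorem exists_mem_fenceOrd {s : Fin (n + 2) → ℝ} (hs : s ∈ fenceCell n)
    (hinj : Function.Injective fun j : Fin (n + 1) => s j.succ) :
    ∃ ρ ∈ fenceSet n, s ∈ fenceOrd ρ := by
  obtain ⟨ρ, hρ⟩ := exists_mem_orderCellK (k := n + 1) (t := fun j => s j.succ)
    (fun j => bounds_of_mem_fenceCell hs j.succ) hinj
  exact ⟨ρ, mem_fenceSet.mpr ((isFenceTail_iff_perm (mem_orderCellK_domain.mp hρ).2.2).mp
    (isFence_iff_tail.mp hs.2.2)), hs, hρ⟩

/-- The uncovered part of `F_n` lies in the tie hyperplanes: it is null. -/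
theorem volume_fenceCell_diff_eq_zero :
    volume (fenceCell n \ ⋃ ρ ∈ fenceSet n, (fenceOrdPiece ρ).domain) = 0 := by
  refine measure_mono_null ?_
    (measure_iUnion_null_iff.mpr fun p : {p : Fin (n + 1) × Fin (n + 1) // p.1 ≠ p.2} =>
      Literature.Analysis.SpecialFunctions.Selberg.volume_setOf_apply_eq
        ((Fin.succ_injective _).ne p.2))
  rintro s ⟨hs, hnot⟩
  by_contra hties
  simp only [mem_iUnion, mem_setOf_eq, not_exists] at hties
  have hinj : Function.Injective fun j : Fin (n + 1) => s j.succ := fun a b hab => by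
    by_contra hne
    exact hties ⟨(a, b), hne⟩ hab
  obtain ⟨ρ, hρ, hmem⟩ := exists_mem_fenceOrd hs hinj
  exact hnot (mem_iUnion₂.mpr ⟨ρ, hρ, hmem⟩)

/-- Distinct pieces are disjoint. -/
theorem fenceOrd_disjoint {ρ ρ' : Equiv.Perm (Fin (n + 1))} (h : ρ ≠ ρ') :
    fenceOrd ρ ∩ fenceOrd ρ' = ∅ := by
  refine eq_empty_of_forall_notMem fun s ⟨h1, h2⟩ => ?_
  have he := orderCellK_domain_disjoint h
  exact (eq_empty_iff_forall_notMem.mp he) _ ⟨h1.2, h2.2⟩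

/-- **Dissection (rule (1))**: `[F_n, w] − Σ_{ρ ∈ fenceSet n} [F_ρ, w] ∈ relations`. -/
theorem fencePiece_sub_sum (n : ℕ) :
    of (fencePiece n) - ∑ ρ ∈ fenceSet n, of (fenceOrdPiece ρ) ∈ relations := by
  refine of_sub_sum_of_mem_relations (fenceSet n) (fencePiece n) fenceOrdPiece
    (fun ρ _ => measure_mono_null (fun t ht => (ht.2 ht.1.1).elim) measure_empty)
    (fun ρ _ t _ => by rw [fenceOrdPiece, angPiece_integrand, fencePiece, angPiece_integrand]) ?_
    (fun ρ _ ρ' _ h => show volume (fenceOrd ρ ∩ fenceOrd ρ') = 0 by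
      rw [fenceOrd_disjoint h, measure_empty])
  exact volume_fenceCell_diff_eq_zero

/-- **`[F_n, w] = Σ_ρ [F_ρ, w]` in `Q`.** -/
theorem mkQ_fencePiece_eq_sum (n : ℕ) :
    mkQ (of (fencePiece n)) = ∑ ρ ∈ fenceSet n, mkQ (of (fenceOrdPiece ρ)) := by
  rw [← map_sum, mkQ_eq_mkQ_iff]
  exact fencePiece_sub_sum n

/-! ## The lifted permutation `(0, ρ + 1)` and its order cell -/

/-- `liftPerm ρ`: `0 ↦ 0`, `j+1 ↦ ρ(j)+1`. -/
def liftPerm (ρ : Equiv.Perm (Fin (n + 1))) : Equiv.Perm (Fin (n + 2)) :=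
  (finSuccEquiv (n + 1)).trans (ρ.optionCongr.trans (finSuccEquiv (n + 1)).symm)

/-- `liftPerm ρ 0 = 0`. -/
@[simp] theorem liftPerm_zero (ρ : Equiv.Perm (Fin (n + 1))) : liftPerm ρ 0 = 0 := by
  simp [liftPerm]

/-- `liftPerm ρ (j+1) = ρ(j)+1`. -/
@[simp] theorem liftPerm_succ (ρ : Equiv.Perm (Fin (n + 1))) (j : Fin (n + 1)) :
    liftPerm ρ j.succ = (ρ j).succ := by
  simp [liftPerm]

/-- The order cell of `liftPerm ρ`: `z₀` on top of `(z₁,…,z_{n+1}) ∈ C_ρ`. -/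
theorem mem_orderCellK_liftPerm {ρ : Equiv.Perm (Fin (n + 1))} {z : Fin (n + 2) → ℝ} :
    z ∈ (orderCellK (liftPerm ρ)).domain ↔ (0 < z 0 ∧ z 0 < 1) ∧
      (fun j => z j.succ) ∈ (orderCellK ρ).domain ∧ z (ρ 0).succ < z 0 := by
  rw [mem_orderCellK_domain, mem_orderCellK_domain]
  simp only [openOrderedSimplex, mem_setOf_eq, Fin.forall_fin_succ, liftPerm_zero, liftPerm_succ,
    Fin.strictAnti_iff_succ_lt, Fin.castSucc_zero, ← Fin.succ_castSucc]
  tauto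

end SoloBlind

end Summit.KontsevichZagierPeriods.KontsevichZagierPeriods.Theorems
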